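import Summits.QuantumFields.BalabanUV.Beta.GAN24.StepCovarianceSandwich
import Summits.QuantumFields.BalabanUV.Beta.GAN24.ValueHessianLevelZero
import Summits.QuantumFields.BalabanUV.Beta.RelInvBorderedHessian

/-!
# `BalabanUV.Beta.GAN24.StepCovarianceSandwichZero` — binder row G-an2-4 ∕ (CONV-C), W-slot (α-0), typer's PART VI row **T6-VAL**, the (γ) hand's letter **K7-0**
# (memo `HOME/b2b-balaban-gan24-formalise-leaf-06/g55/HX-VALUES-g55.md` §6): **THIS LINEAGE's L4 SANDWICH HOLDS AT LEVEL `0` VERBATIM** —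
# `(E2_0 ∘ G_0 ∘ E2_0)(x,u)_{inl κ, inl β} + (𝒬ᵀ_{Lc} E2_1 𝒬_{Lc})(x,u)_{κβ} = E2_0(x,u)_{κβ}`, `G_0 = coDressKBmAt ρ Lc (KInvStep Lc 0)` the block-mean co-dressed LEVEL-`0` step
# covariance, `E2_0 = d*d` the Wilson Hessian (`ValueHessianLevelZero`), `E2_1 = wΦ_{Lc}` the value Hessian one level up, `wVH_0 = 1` — every in-block root, every `d`, every `Lc ≥ 1`,
# entrywise as kernels (G-an2-4 CRUX TEAM (2), seat `b2b-balaban-gan24-formalise-leaf-06` = the (γ) hand, gen 57; journal [GAN24LEAF06-G57-INTENT-1])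

NOT IN PRINT; OUR BOOKKEEPING ([folklore] the proof of `StepCovarianceSandwich.wVH_mul_sandwich_add_tent` with `j + 1 ↦ 0`, BY NAME over: an2 gen 13's LEVEL-`0` product identity
`RelInvBorderedHessian.comp_bhK_coDressKBmAt_KInv` (`bhK_{Lc} ∘ G_0 = piKBmC`) with `KInvStep_zero_eq`, the action lemma `BorderedHessianKernelAction.comp_bhK_inl`
(`(bhK ∘ X)_{f} = d*d X_{·zb} − 𝒬ᵀ(mcol X)`), this seat's `ValueHessianLevelZero.tsum_E2_zero_apply` (`E2_0 X_{·zb} = d*d X_{·zb}`), the tools `StepCovarianceSandwich.comp_piKBmC_E2 ∕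
lamCoeffK_coDressKBmAt_E2 ∕ contourSumAdj_neg_const_mul ∕ sandwich_coDressKBmAt_eq_undressed` AT `j = 0`, and road-p1 g20's tent `RespStepEffectiveEL.lamCoeffK_KInvStep_E2_eq_neg_contourSumAdj`
AT `j = 0` (stated for every `j`; `(Lc^0)^{d+2} = 1`); 0 `def`, 0 cited fact, 0 `def … : Prop`, 0 sorry).
HONEST FRAMING (cell contract, verbatim): «discharging `BetaPertH` makes Bałaban's UV stability UNCONDITIONAL — a real constructive-QFT result; it is NOT the continuum
limit and NOT the Clay problem.»  HONEST DEPENDENCY (verbatim): «continuum YM on T⁴ ⇐ BetaPertH ∧ nine spine estimates (0/9 proved); BetaPertH ⇐ (D1) ∧ (D4) ∧ CAP+tail;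
G-an2-4 gates asym, D1 and NE2/3/4.»

WHY.  Row T6-VAL's depth tower (this lineage's `CrossedLedgerTelescope`, leaf-03's `CrossedLedgerClosure`) needs, besides the shapes at levels `≥ 1` (K7-a, typed: `FaceWordEEValueDeep` &c.,
staged), the LEVEL-`0` shape `hface0`: the face words of the level-`0` forcing (Wilson cubic through `G_0`) at the deep periods.  Their E⊗E part is, word for word, the same cell
pairing `⟨E2_0 qL, G_0 (E2_0 qR)⟩` (the Wilson face currents ARE `E2_0`-images of K2's profiles — this seat's `WilsonFaceCurrentProfile`), so the level-`0` value is K5's bridge once THIS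
sandwich is known at level `0`.  ENGINE (weight 0; this lineage's g56 `level0.py`, kit j222767, D = 2): the level-`0` word splits EXACTLY as `R − T` (Schur ∕ bridge), `T` the `wΦ`-tent.

WHAT ([folklore]; generic `d`, in-block root `toSite r`, `Lc ≥ 1` via `NeZero`):
* §1 **`sandwich_add_tent_zero`** — the display; **`sandwich_inl_inl_zero`** — solved for the sandwich, with the factor `(wVH d Lc 0)⁻¹` kept so that K5's text transposes
  letter by letter (`wVH d Lc 0 = 1` is the tree's `ReflectionLocusSymShift.wVH_zero` ∕ `DepthTowerPrefactors.units_eq`; proved inline here, NOT restated — v1.1); `sandwich_inl_inl_zero'` — without the factor;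
* §2 **`sandwich_KInv_inl_inl`** — the UNDRESSED level-`0` sandwich `(E2_0 ∘ KInvStep Lc 0 ∘ E2_0)_{ff} = E2_0 − 𝒬ᵀ E2_1 𝒬` (root-free; `sandwich_coDressKBmAt_eq_undressed` at `j = 0`).
Asserts NO value of Bałaban's tables; discharges NOTHING of `hX` ∕ `hXu` ∕ (C)_{≥1} ∕ `hB0` ∕ `hBF` ∕ (Q-L) ∕ (hW, hWall); NEVER «G-an2-4 closed» as (CONV-C); NOT D1, NOT `BetaPertH`,
NOT continuum, NOT Clay.  2026-08-24; no existing file touched.  v1.1 (leaf-06 g58): the helper `wVH_zero` (a statement-level twin of the tree's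
`ReflectionLocusSymShift.wVH_zero` — the gate's `dedup.landed`) is no longer declared; statements of §1–§2 byte-identical to v1 (p384143).
-/

noncomputable section

open Finset
open scoped BigOperators
open Literature.MathematicalPhysics.QuantumFieldTheory
open Literature.MathematicalPhysics.QuantumFieldTheory.Balaban1983to89
open Literature.MathematicalPhysics.QuantumFieldTheory.Balaban1983to89.Beta
open ExpKernelCalculus (MKer Decays comp)
open AffineAveraging (Form1 box toSite curv curvAdj)
open AffineReproduction (contourSumAdj)
open KernelSpecInstance (wΦ)
open OneStepResolventKernel (Fib KInv)
open OneStepKernelFamily (KInvStep)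
open BalabanStepJetsSucc (E2 wVH lamCoeffK)
open Summit.QuantumFields.BalabanUV.Beta.TameKernelCalculus
open Summit.QuantumFields.BalabanUV.Beta.AxialDressingRooted (piKBmC coDressKBmAt spr_coDressKBmAt one_le_of_neZero)
open Summit.QuantumFields.BalabanUV.Beta.BorderedHessian (bhK spr_bhK spr_KInvStep fcol mcol mcol_apply comp_bhK_inl E2_inl_inl_eq_wΦ comp_E2_apply_inl
  comp_bhK_coDressKBmAt_KInv KInvStep_zero_eq)
open Summit.QuantumFields.BalabanUV.Beta.GAN24.RespStepEffectiveEL (lamCoeffK_KInvStep_E2_eq_neg_contourSumAdj)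
open Summit.QuantumFields.BalabanUV.Beta.GAN24.StepCovarianceSandwich (spr_E2 comp_piKBmC_E2 lamCoeffK_coDressKBmAt_E2 contourSumAdj_neg_const_mul
  sandwich_coDressKBmAt_eq_undressed)
open Summit.QuantumFields.BalabanUV.Beta.GAN24.ValueHessianLevelZero (tsum_E2_zero_apply)

namespace Summit.QuantumFields.BalabanUV.Beta.GAN24.StepCovarianceSandwichZero

variable {d : ℕ} {Lc : ℕ} [NeZero Lc]

/-! ## §1 The level-`0` sandwich -/

/-- NOT IN PRINT; OUR BOOKKEEPING.  **THE WILSON HESSIAN TELESCOPES THROUGH THE DRESSED LEVEL-`0` STEP COVARIANCE** (every in-block root `toSite r`):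
`(E2_0 ∘ G_0 ∘ E2_0)(x,u)_{inl κ, inl β} + 𝒬ᵀ_{Lc}[m,y′ ↦ 𝒬ᵀ_{Lc}[κ′,y″ ↦ E2_1(y″,y′)_{κ′ m}](β,u)](κ,x) = E2_0(x,u)_{κβ}`, `G_0 = coDressKBmAt (toSite r) Lc (KInvStep Lc 0)`. -/
theorem sandwich_add_tent_zero {r : Fin (d + 1) → ℕ} (hr : r ∈ box (d + 1) Lc) (x u : Fin (d + 1) → ℤ) (κ β : Fin (d + 1)) :
    comp (comp (E2 d Lc 0) (coDressKBmAt (toSite r) Lc (KInvStep (d := d) Lc 0))) (E2 d Lc 0) x u (Sum.inl κ) (Sum.inl β) +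
      contourSumAdj Lc (fun m y' => contourSumAdj Lc (fun κ' y'' => E2 d Lc 1 y'' y' (Sum.inl κ') (Sum.inl m)) β u) κ x =
      E2 d Lc 0 x u (Sum.inl κ) (Sum.inl β) := by
  have hLc : 1 ≤ Lc := one_le_of_neZero Lc
  set K : MKer (d + 1) (Fib d) := KInvStep (d := d) Lc 0 with hKdef
  set G : MKer (d + 1) (Fib d) := coDressKBmAt (toSite r) Lc K with hGdef
  set E : MKer (d + 1) (Fib d) := E2 d Lc 0 with hEdef
  have sK : Spr K := spr_KInvStep 0
  have sG : Spr G := spr_coDressKBmAt hLc hr sK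
  have sE : Spr E := spr_E2 0
  have sM : Spr (bhK (d := d) Lc) := spr_bhK hLc
  -- the field row of an2 gen 13's LEVEL-0 product identity, right-composed with `E`
  have key : comp (comp (bhK Lc) G) E = E := by
    rw [hGdef, hKdef, KInvStep_zero_eq, comp_bhK_coDressKBmAt_KInv hr, hEdef, comp_piKBmC_E2 hr 0]
  rw [← comp_assoc_tame sM.tame sG.tame sE.tame] at key
  have ekey := congrFun (congrFun (congrFun (congrFun key x) u) (Sum.inl κ)) (Sum.inl β)
  rw [comp_bhK_inl Lc (comp G E) x u κ (Sum.inl β)] at ekey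
  -- the `d*d` part is the sandwich (`E2_0 = d*d`)
  have h1 : curvAdj (curv (fcol (comp G E) u (Sum.inl β))) κ x = comp (comp E G) E x u (Sum.inl κ) (Sum.inl β) := by
    rw [← tsum_E2_zero_apply Lc (comp G E) x u κ (Sum.inl β), ← comp_assoc_tame sE.tame sG.tame sE.tame, hEdef, comp_E2_apply_inl]
    exact tsum_congr fun y => Finset.sum_congr rfl fun l _ => by rw [E2_inl_inl_eq_wΦ]
  -- the multiplier column of `G ∘ E` is road-p1's tent at `j = 0`
  have h2 : mcol Lc (comp G E) u (Sum.inl β) = fun m y' =>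
      -((((Lc ^ 0 : ℕ) : ℝ) ^ (d + 2))⁻¹ *
        contourSumAdj Lc (fun κ' y'' => E2 d Lc 1 y'' y' (Sum.inl κ') (Sum.inl m)) β u) := by
    funext m y'
    rw [mcol_apply, show comp G E (((Lc : ℕ) : ℤ) • y') u (Sum.inr m) (Sum.inl β) = lamCoeffK G E Lc m y' β u from rfl, hGdef, hEdef,
      lamCoeffK_coDressKBmAt_E2 hr sK 0, hKdef, lamCoeffK_KInvStep_E2_eq_neg_contourSumAdj 0 m y' β u]
    congr 3
    funext κ' y''
    rw [E2_inl_inl_eq_wΦ]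
  rw [h1, h2, contourSumAdj_neg_const_mul] at ekey
  have hunit : (((Lc ^ 0 : ℕ) : ℝ) ^ (d + 2))⁻¹ = 1 := by
    rw [pow_zero, Nat.cast_one, one_pow, inv_one]
  rw [hunit, one_mul, sub_neg_eq_add] at ekey
  rw [← ekey]

/-- NOT IN PRINT; OUR BOOKKEEPING.  **THE LEVEL-`0` SANDWICH IN CLOSED FORM, L4's LETTERS** (the factor `(wVH d Lc 0)⁻¹ = 1` kept so that K5's text transposes to level `0` letter by
letter): `(E2_0 ∘ G_0 ∘ E2_0)(x,u)_{inl κ, inl β} = wVH_0⁻¹·(E2_0(x,u)_{κβ} − (𝒬ᵀ_{Lc} E2_1 𝒬_{Lc})(x,u)_{κβ})`. -/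
theorem sandwich_inl_inl_zero {r : Fin (d + 1) → ℕ} (hr : r ∈ box (d + 1) Lc) (x u : Fin (d + 1) → ℤ) (κ β : Fin (d + 1)) :
    comp (comp (E2 d Lc 0) (coDressKBmAt (toSite r) Lc (KInvStep (d := d) Lc 0))) (E2 d Lc 0) x u (Sum.inl κ) (Sum.inl β) =
      (wVH d Lc 0)⁻¹ *
        (E2 d Lc 0 x u (Sum.inl κ) (Sum.inl β) -
          contourSumAdj Lc (fun m y' => contourSumAdj Lc (fun κ' y'' => E2 d Lc 1 y'' y' (Sum.inl κ') (Sum.inl m)) β u) κ x) := by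
  have hw : wVH d Lc 0 = 1 := by
    unfold BalabanStepJetsSucc.wVH
    rw [pow_zero, one_pow]
  rw [hw, inv_one, one_mul]
  exact eq_sub_of_add_eq (sandwich_add_tent_zero hr x u κ β)

/-- NOT IN PRINT; OUR BOOKKEEPING.  **… WITHOUT THE UNIT FACTOR**: `(E2_0 ∘ G_0 ∘ E2_0)(x,u)_{inl κ, inl β} = E2_0(x,u)_{κβ} − (𝒬ᵀ_{Lc} E2_1 𝒬_{Lc})(x,u)_{κβ}`. -/
theorem sandwich_inl_inl_zero' {r : Fin (d + 1) → ℕ} (hr : r ∈ box (d + 1) Lc) (x u : Fin (d + 1) → ℤ) (κ β : Fin (d + 1)) :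
    comp (comp (E2 d Lc 0) (coDressKBmAt (toSite r) Lc (KInvStep (d := d) Lc 0))) (E2 d Lc 0) x u (Sum.inl κ) (Sum.inl β) =
      E2 d Lc 0 x u (Sum.inl κ) (Sum.inl β) -
        contourSumAdj Lc (fun m y' => contourSumAdj Lc (fun κ' y'' => E2 d Lc 1 y'' y' (Sum.inl κ') (Sum.inl m)) β u) κ x :=
  eq_sub_of_add_eq (sandwich_add_tent_zero hr x u κ β)

/-! ## §2 The undressed level-`0` sandwich -/

/-- NOT IN PRINT; OUR BOOKKEEPING.  **THE UNDRESSED LEVEL-`0` SANDWICH IN CLOSED FORM** (root-free): `(E2_0 ∘ KInvStep Lc 0 ∘ E2_0)(x,u)_{inl κ, inl β} =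
E2_0(x,u)_{κβ} − (𝒬ᵀ_{Lc} E2_1 𝒬_{Lc})(x,u)_{κβ}` — the block-mean co-dressing of the middle resolvent is invisible between two value Hessians (`sandwich_coDressKBmAt_eq_undressed` at
`j = 0`; any in-block root witnesses §1). -/
theorem sandwich_KInv_inl_inl (x u : Fin (d + 1) → ℤ) (κ β : Fin (d + 1)) :
    comp (comp (E2 d Lc 0) (KInvStep (d := d) Lc 0)) (E2 d Lc 0) x u (Sum.inl κ) (Sum.inl β) =
      E2 d Lc 0 x u (Sum.inl κ) (Sum.inl β) -
        contourSumAdj Lc (fun m y' => contourSumAdj Lc (fun κ' y'' => E2 d Lc 1 y'' y' (Sum.inl κ') (Sum.inl m)) β u) κ x := by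
  have hr : (fun _ : Fin (d + 1) => (0 : ℕ)) ∈ box (d + 1) Lc := by
    simp only [AffineAveraging.box, Fintype.mem_piFinset, Finset.mem_range]
    exact fun _ => Nat.pos_of_ne_zero (NeZero.ne Lc)
  rw [← sandwich_coDressKBmAt_eq_undressed hr (spr_KInvStep 0) 0, sandwich_inl_inl_zero' hr]

end Summit.QuantumFields.BalabanUV.Beta.GAN24.StepCovarianceSandwichZero

end
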